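import Literature.AlgebraicGeometry.Frobenioids.EndomorphismsNonDilatingWitness
import Literature.AlgebraicGeometry.Frobenioids.ModelFrobenioidIsFrobenioid
import HarnessLib

/-!
# Frobenioids I, Prop. 1.12 (ii)/(iii) fail in the MODEL Frobenioid of Thm. 5.2 over `(B(ℤ), ℕ^ℤ, shift)` —
# for EVERY rational-function monoid `B`

Mochizuki, *The geometry of Frobenioids I*, Kyushu J. Math. **62** (2008), §1 Prop. 1.12 (ii)–(iii), kurims p. 39
[cite: MochizukiFrdI2008, Prop. 1.12 p.39]; §5 Thm. 5.2 (i)–(ii), pp. 100–101 (the model Frobenioid `C` of the data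
`(D, Φ, B, Div_B : B → Φ^gp)`) [cite: MochizukiFrdI2008, Thm. 5.2(i) p.100].  Context: [EtTh] Def. 3.6 (ii), PDF p. 77:
"the data `(D, Φ, B, B → Φ^gp)` determines a model Frobenioid `C`" [cite: MochizukiEtTh2009, Def 3.6 p.77].

PROOF-STYLE SEQUEL (abc-iut cell, block F, seat abc-iut-f-039 gen 2; rows F-1076/F-1077/F-1078; referee item P12-NE)
of `EndomorphismsNonDilatingWitness.lean` (`D = B(ℤ)`, `Φ(⋆) = ℕ^ℤ` with the shift, non-dilating and divisorial).
That file works in the ELEMENTARY Frobenioid `F_Φ` (no unit / rational-function data).  Here the same square is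
realised inside the MODEL Frobenioid `C(Φ, B, Div_B)` of [FrdI] Thm. 5.2 for an ARBITRARY monoid `B` on `B(ℤ)` and an
arbitrary `Div_B`: objects `O = (⋆, 0)` and `X = (⋆, [x])`, `x = 𝟙_{[0,∞)}`; morphisms `φ = (1, id, x, 1) : O → X`,
`β = (1, b, 0, 1) ∈ Aut(O)`, `α = (1, b, δ, 1) : X → X` (a morphism BECAUSE `b^* x = x + δ`, i.e. `[x] + δ = b^*[x]`),
all with unit coordinate `1 ∈ B(⋆)`.  PROVED, for every `B`, `Div_B`: `φ ∘ β = α ∘ φ`; `α` is a linear base-isomorphic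
sub-automorphism of `X` with `Div(α) = δ ≠ 0`, not an isomorphism (isomorphisms over a divisorial `Φ` have divisor `0`,
tree `ModelFrobenioid.div_eq_one_of_isIso`); hence at `X` the printed Prop. 1.12 (ii) [necessity and the `iff`] and
the sufficiency of (iii) FAIL, and `AutFixesDiv` fails, for `C(Φ, B, Div_B) → F_Φ` (`ModelFrobenioid.toElem`); and
`C(Φ, B, Div_B)` IS a Frobenioid whenever `B` is a group-like monoid on `B(ℤ)` (tree `ModelFrobenioid.isFrobenioid`,
Thm. 5.2 (ii)).  Summary `forall_ratFn_not_prop112_model`.  So the failure recorded in the companion file is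
insensitive to the unit / rational-function data — the only structural ingredient by which the tempered Frobenioids
of [EtTh] Def. 3.6 differ, at the level of [FrdI] Thm. 5.2, from `F_Φ`.  ((iv) is not re-derived here: `X` need not
be `Aut^sub`-ample in `C(Φ, B, Div_B)` — over `b⁻¹` a lift needs a rational function with divisor `−𝟙_{{0}}`.)

HONEST FRAMING: kernel-checked statements about the typed [FrdI] notions at a constructed base `B(ℤ)`; nothing is
asserted about the actual tempered Frobenioids of [EtTh] (typed in the tree as an interface), nor about the author's
intended hypothesis; Prop. 1.12 is cited by no node of the cone under [IUTchIII] Cor. 3.12; no side taken on Cor. 3.12.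
-/

namespace Literature.AlgebraicGeometry.Frobenioids

open CategoryTheory Opposite

namespace EndomorphismsNonDilatingWitness

/-! ### §7 The same failure inside the MODEL Frobenioid of [FrdI] Thm. 5.2, for EVERY rational-function monoid `B` -/

section Model

variable (B : Dᵒᵖ ⥤ CommMonCat.{0}) (DivB : B ⟶ monoidGp Φ)

/-- The Frobenius-trivial object `O = (⋆, 0)` of the model Frobenioid `C(Φ, B, Div_B)` ([FrdI] Thm. 5.2 (i)).
[cite: MochizukiFrdI2008, Thm. 5.2(i) p.100] -/
abbrev O : ModelFrobenioid Φ B DivB := ModelFrobenioid.zeroObj Φ B DivB (SingleObj.star G)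

/-- The object `X = (⋆, [x])`, `x = 𝟙_{[0,∞)}`, of the model Frobenioid. [cite: MochizukiFrdI2008, Thm. 5.2(i) p.100] -/
def X : ModelFrobenioid Φ B DivB := ⟨SingleObj.star G, Algebra.GrothendieckGroup.of xDiv⟩

/-- `φ = (1, id, x, 1) : O → X` (relation: `0 + x = [x] + Div_B(1)`). [cite: MochizukiFrdI2008, Thm. 5.2(i) p.100] -/
def φm : O B DivB ⟶ X B DivB :=
  ModelFrobenioid.mkHom _ _ 1 (𝟙 (SingleObj.star G)) xDiv 1 (by
    show (1 : Algebra.GrothendieckGroup M) ^ ((1 : ℕ+) : ℕ) * Algebra.GrothendieckGroup.of xDiv =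
      pullGp Φ (𝟙 (SingleObj.star G)) (Algebra.GrothendieckGroup.of xDiv) * divB Φ B DivB _ 1
    rw [one_pow, one_mul, map_one (divB Φ B DivB _), mul_one, pullGp_id])

/-- `β = (1, b, 0, 1) : O → O`, `b = 1 ∈ ℤ`. [cite: MochizukiFrdI2008, Thm. 5.2(i) p.100] -/
def βm : O B DivB ⟶ O B DivB := ModelFrobenioid.zeroHom 1 (baseHom (Multiplicative.ofAdd 1))

/-- `β⁻¹ = (1, b⁻¹, 0, 1)`. [cite: MochizukiFrdI2008, Thm. 5.2(i) p.100] -/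
def βmInv : O B DivB ⟶ O B DivB := ModelFrobenioid.zeroHom 1 (baseHom (Multiplicative.ofAdd (-1)))

/-- `β` is an automorphism of `O` (for ANY `B`: its unit coordinate is `1`). [cite: MochizukiFrdI2008, Thm. 5.2(i) p.100] -/
def βmIso : O B DivB ≅ O B DivB where
  hom := βm B DivB
  inv := βmInv B DivB
  hom_inv_id := by
    show ModelFrobenioid.zeroHom 1 _ ≫ ModelFrobenioid.zeroHom 1 _ = _
    rw [ModelFrobenioid.zeroHom_comp, mul_one, ← ModelFrobenioid.zeroHom_id]
    congr 1
  inv_hom_id := by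
    show ModelFrobenioid.zeroHom 1 _ ≫ ModelFrobenioid.zeroHom 1 _ = _
    rw [ModelFrobenioid.zeroHom_comp, mul_one, ← ModelFrobenioid.zeroHom_id]
    congr 1

/-- `α = (1, b, δ, 1) : X → X` — a morphism for ANY `B` because `[x] + δ = b^*[x]` (`b^* x = x + δ`).
[cite: MochizukiFrdI2008, Thm. 5.2(i) p.100] -/
def αm : X B DivB ⟶ X B DivB :=
  ModelFrobenioid.mkHom _ _ 1 (baseHom (Multiplicative.ofAdd 1)) dDiv 1 (by
    show Algebra.GrothendieckGroup.of xDiv ^ ((1 : ℕ+) : ℕ) * Algebra.GrothendieckGroup.of dDiv =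
      pullGp Φ (baseHom (Multiplicative.ofAdd 1)) (Algebra.GrothendieckGroup.of xDiv) * divB Φ B DivB _ 1
    rw [PNat.one_coe, pow_one, map_one (divB Φ B DivB _), mul_one, pullGp_of]
    show _ = Algebra.GrothendieckGroup.of (shiftHom 1 xDiv)
    rw [shiftHom_one_xDiv, map_mul, mul_comm])

/-- `φ ∘ β = α ∘ φ` in the model Frobenioid. [cite: MochizukiFrdI2008, Prop. 1.12 p.39] -/
theorem sq_model : βm B DivB ≫ φm B DivB = φm B DivB ≫ αm B DivB := by
  refine ModelFrobenioid.hom_ext rfl ?_ ?_ ?_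
  · show baseHom (Multiplicative.ofAdd 1) ≫ 𝟙 _ = 𝟙 _ ≫ baseHom (Multiplicative.ofAdd 1)
    rw [Category.comp_id, Category.id_comp]
  · rw [ModelFrobenioid.div_comp_pull, ModelFrobenioid.div_comp_pull]
    show shiftHom 1 xDiv * (1 : M) ^ ((1 : ℕ+) : ℕ) = shiftHom 0 dDiv * xDiv ^ ((1 : ℕ+) : ℕ)
    rw [shiftHom_one_xDiv, shiftHom_zero, one_pow, mul_one, PNat.one_coe, pow_one, MonoidHom.id_apply]
  · rw [ModelFrobenioid.unit_comp_pull, ModelFrobenioid.unit_comp_pull]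
    have h1 : ModelFrobenioid.unit (φm B DivB) = 1 := rfl
    have h2 : ModelFrobenioid.unit (βm B DivB) = 1 := rfl
    have h3 : ModelFrobenioid.unit (αm B DivB) = 1 := rfl
    rw [h1, h2, h3, map_one (pull B _), map_one (pull B _), one_pow, one_pow]

/-- `α` is a sub-automorphism of `X` in the model Frobenioid. [cite: MochizukiFrdI2008, Prop. 1.12 p.39] -/
theorem isSubAutomorphism_αm : IsSubAutomorphism (αm B DivB) := ⟨O B DivB, φm B DivB, βmIso B DivB, sq_model B DivB⟩

/-- `α` is a base-isomorphism. [cite: MochizukiFrdI2008, Prop. 1.12 p.39] -/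
theorem isBaseIso_αm : PreFrobenioid.IsBaseIso (ModelFrobenioid.toElem Φ B DivB) (αm B DivB) := by
  show IsIso (baseHom (Multiplicative.ofAdd 1))
  infer_instance

/-- `α` is not isometric (`Div(α) = δ ≠ 0`). [cite: MochizukiFrdI2008, Prop. 1.12(ii) p.39] -/
theorem not_isIsometry_αm : ¬ PreFrobenioid.IsIsometry (ModelFrobenioid.toElem Φ B DivB) (αm B DivB) := fun h =>
  not_isUnit_dDiv (by rw [show dDiv = 1 from h]; exact isUnit_one)

/-- `α` is not an isomorphism (isomorphisms of a model Frobenioid over a divisorial `Φ` have zero divisor `0`) —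
for ANY `B`. [cite: MochizukiFrdI2008, Prop. 1.12(iii) p.39] -/
theorem not_isIso_αm : ¬ IsIso (αm B DivB) := fun h =>
  not_isUnit_dDiv (by
    rw [show dDiv = 1 from @ModelFrobenioid.div_eq_one_of_isIso _ _ _ _ _ _ _ objectwise_isDivisorial (αm B DivB) h]
    exact isUnit_one)

/-- The model Frobenioid `C(Φ, B, Div_B)` over `B(ℤ)` is a Frobenioid as soon as `B` is a group-like monoid on `B(ℤ)`
([FrdI] Thm. 5.2 (ii), tree `ModelFrobenioid.isFrobenioid`). [cite: MochizukiFrdI2008, Thm. 5.2(ii) p.101] -/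
theorem isFrobenioid_model (hB : IsMonoidOn B) (hBg : Objectwise (fun N _ => IsGroupLike N) B) :
    PreFrobenioid.IsFrobenioid (ModelFrobenioid.toElem Φ B DivB) :=
  ModelFrobenioid.isFrobenioid isMonoidOn_Φ objectwise_isDivisorial hB hBg isGraphConnected_D isTotallyEpimorphic_D

/-- Prop. 1.12 (ii), printed necessity, fails in the model Frobenioid at `X`, for every `B`.
[cite: MochizukiFrdI2008, Prop. 1.12(ii) p.39] -/
theorem not_subAutomorphismIsIsometryStatement_model :
    ¬ PreFrobenioid.SubAutomorphismIsIsometryStatement (ModelFrobenioid.toElem Φ B DivB) (X B DivB) :=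
  fun h => not_isIsometry_αm B DivB (h _ (isSubAutomorphism_αm B DivB))

/-- Prop. 1.12 (ii) as printed fails in the model Frobenioid at `X`, for every `B`. [cite: MochizukiFrdI2008, Prop. 1.12(ii) p.39] -/
theorem not_endoIsSubAutomorphismIffStatement_model :
    ¬ PreFrobenioid.EndoIsSubAutomorphismIffStatement (ModelFrobenioid.toElem Φ B DivB) (X B DivB) :=
  fun h => not_isIsometry_αm B DivB ((h _).mp (isSubAutomorphism_αm B DivB)).1

/-- Prop. 1.12 (iii), printed sufficiency, fails in the model Frobenioid at `X`, for every `B`.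
[cite: MochizukiFrdI2008, Prop. 1.12(iii) p.39] -/
theorem not_subAutomorphismIsIsoIffStatement_model :
    ¬ PreFrobenioid.SubAutomorphismIsIsoIffStatement (ModelFrobenioid.toElem Φ B DivB) (X B DivB) :=
  fun h => not_isIso_αm B DivB ((h _ (isSubAutomorphism_αm B DivB)).mpr (isBaseIso_αm B DivB))

/-- `AutFixesDiv` fails for the model Frobenioid, for every `B` (`Base(β)^* Div(φ) = x + δ ≠ x`).
[cite: MochizukiFrdI2008, Prop. 1.12(ii) p.39] -/
theorem not_autFixesDiv_model : ¬ PreFrobenioid.AutFixesDiv (ModelFrobenioid.toElem Φ B DivB) := by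
  intro hH
  have h : shiftHom 1 xDiv = xDiv := hH (βmIso B DivB) (φm B DivB)
  rw [shiftHom_one_xDiv] at h
  have h1 := congrArg (fun z : M => Multiplicative.toAdd z (-1)) h
  simp only [toAdd_mul, Pi.add_apply, toAdd_dDiv_neg_one] at h1
  omega

/-- **Summary, model form.**  For EVERY rational-function monoid `B` on `B(ℤ)` and every `Div_B : B → Φ^gp`, the
model Frobenioid `C(Φ, B, Div_B)` of [FrdI] Thm. 5.2 — the construction [EtTh] Def. 3.6 (ii) invokes — contains the
object `X = (⋆, [𝟙_{[0,∞)}])` carrying a linear base-isomorphic sub-automorphism with nonzero divisor; the printed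
Prop. 1.12 (ii) [both forms], (iii) and the hypothesis `AutFixesDiv` fail there, and `C` IS a Frobenioid whenever
`B` is a group-like monoid on `B(ℤ)`.  The failure is insensitive to the unit / rational-function data.
[cite: MochizukiFrdI2008, Prop. 1.12 p.39] -/
theorem forall_ratFn_not_prop112_model :
    ∀ (B : Dᵒᵖ ⥤ CommMonCat.{0}) (DivB : B ⟶ monoidGp Φ),
      (IsMonoidOn B → Objectwise (fun N _ => IsGroupLike N) B →
        PreFrobenioid.IsFrobenioid (ModelFrobenioid.toElem Φ B DivB)) ∧
      ∃ Y : ModelFrobenioid Φ B DivB,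
        ¬ PreFrobenioid.SubAutomorphismIsIsometryStatement (ModelFrobenioid.toElem Φ B DivB) Y ∧
        ¬ PreFrobenioid.EndoIsSubAutomorphismIffStatement (ModelFrobenioid.toElem Φ B DivB) Y ∧
        ¬ PreFrobenioid.SubAutomorphismIsIsoIffStatement (ModelFrobenioid.toElem Φ B DivB) Y ∧
        ¬ PreFrobenioid.AutFixesDiv (ModelFrobenioid.toElem Φ B DivB) :=
  fun B DivB => ⟨isFrobenioid_model B DivB, X B DivB, not_subAutomorphismIsIsometryStatement_model B DivB,
    not_endoIsSubAutomorphismIffStatement_model B DivB, not_subAutomorphismIsIsoIffStatement_model B DivB,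
    not_autFixesDiv_model B DivB⟩

end Model

end EndomorphismsNonDilatingWitness

end Literature.AlgebraicGeometry.Frobenioids
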